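import Summits.HodgeConjecture.CorCM.MumfordTateRankRigidMonotone
import Literature.AlgebraicGeometry.Motives.HodgeLieRigidTransport
import Literature.AlgebraicGeometry.Pohlmann1968.SimpleCMAbelianVarietyHazamaCriterion
import HarnessLib

/-!
# `Θ`-rigidity of `H¹` is an ISOGENY INVARIANT of a complex abelian variety; `t(X × Y) ≥ t(X)` for every `X` isogenous to a `Θ`-rigid model
# (Moonen 1999 (1.7)–(1.8): `MT` of isomorphic Hodge structures; Moonen–Zarhin 1999 §3 (3.1))

COR-CM (cell `pub-hodgecm2`, seat `b27` gen 51, count-neutral Mumford–Tate-rank ladder; theorems only, no definition, no named fact;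
UNCONDITIONAL — nothing here uses or asserts HC_CM).  Notation `t(X) = dim MT(H¹X)`.

An isogeny `g : X ⟶ X'` identifies `H¹(X') = e^* H¹(X)` along `e = g^*` (`hodge_one_eq_comapEquiv_of_isIsogeny`, `Pohlmann1968/…HazamaCriterion`), and
`Θ`-rigidity passes along `e^*` (`Motives/HodgeLieRigidTransport`).  So the `Θ`-RIGID factors of the ladder (simple type-IV(2,1) threefolds, Ribet
type `(g−1,1)`, simple CM surfaces, non-CM curves, QM/RM/generic surfaces, and the towers `A × E₀ × ⋯ × E_m` of gen 50/51) may be replaced by anything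
isogenous to them in the monotonicity theorem `t(X₁ × X₂) ≥ t(X₁)` of `CorCM/MumfordTateRankRigidMonotone`.

* **`hodgeLie_rigid_of_isIsogenous`** — `X ∼ X'` and `H¹X` `Θ`-rigid ⟹ `H¹X'` `Θ`-rigid.
* **`mtRank_hodge_one_le_of_isIsogenous_prod_of_isIsogenous_rigid`** — `X₁ ∼ R` with `H¹R` `Θ`-rigid ⟹ `t(R) ≤ t(X)` for every `X ∼ X₁ × X₂`.

## References
* [Moonen1999MTNotes] B. Moonen, *Notes on Mumford–Tate groups* (1999), (1.7), (1.8). [cite: Moonen1999MTNotes, (1.7) and (1.8)]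
* [MoonenZarhin1999LowDim] B. Moonen, Yu. G. Zarhin, Math. Ann. 315 (1999), §1 and §3 (3.1) [corpus: paper:arxiv-math_9901113 pp. 2, 6].
  [cite: MoonenZarhin1999LowDim, §3 (3.1)]
* [VoisinHodgeI2002] C. Voisin, *Hodge Theory and Complex Algebraic Geometry I*, §7.3.2. [cite: VoisinHodgeI2002, §7.3.2]
-/

noncomputable section

open CategoryTheory CategoryTheory.Limits Module

namespace Summit.HodgeConjecture.CorCM

open Literature.AlgebraicGeometry.Motives
open Literature.AlgebraicGeometry.Motives.AbelianVariety
open Literature.AlgebraicGeometry.Motives.HodgeStructure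
open Literature.AlgebraicGeometry.HodgeTheory

variable [HodgeTensorFacts.{0, 0}] {X X' X₁ X₂ R : AbelianVariety ℂ} {n n' n₁ : ℕ}

/-- **`Θ`-rigidity of `H¹` is an isogeny invariant**: `X ∼ X'` and `H¹X` `Θ`-rigid ⟹ `H¹X'` `Θ`-rigid (`H¹X' = e^* H¹X` for `e = g^*`, `g : X ⟶ X'` an
isogeny, and `Motives/HodgeLieRigidTransport`). [cite: Moonen1999MTNotes, (1.7) and (1.8)] [cite: VoisinHodgeI2002, §7.3.2] -/
theorem hodgeLie_rigid_of_isIsogenous (hX : IsSmoothProjective n X.X) (hX' : IsSmoothProjective n' X'.X) (h : IsIsogenous X X')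
    (hrig : haveI := BettiUniverse.finite hX 1
      ∀ 𝔞 : Submodule ℚ (Module.End ℚ (bettiCohomology X.X 1)),
        𝔞 ≤ (BettiUniverse.hodge exists_isReal_hodgeModel_holds hX 1).hodgeLie →
        (∀ B ∈ 𝔞, ∀ B' ∈ 𝔞, B * B' - B' * B ∈ 𝔞) →
        (∃ Θ ∈ Submodule.span ℂ ((fun B : Module.End ℚ (bettiCohomology X.X 1) => B.baseChange ℂ) ''
            (𝔞 : Set (Module.End ℚ (bettiCohomology X.X 1)))),
          ∀ p, ∀ x ∈ (BettiUniverse.hodge exists_isReal_hodgeModel_holds hX 1).piece p (((1 : ℕ) : ℤ) - p),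
            Θ x = ((2 * p - ((1 : ℕ) : ℤ) : ℤ) : ℂ) • x) →
        (BettiUniverse.hodge exists_isReal_hodgeModel_holds hX 1).hodgeLie ≤ 𝔞) :
    haveI := BettiUniverse.finite hX' 1
    ∀ 𝔞 : Submodule ℚ (Module.End ℚ (bettiCohomology X'.X 1)),
      𝔞 ≤ (BettiUniverse.hodge exists_isReal_hodgeModel_holds hX' 1).hodgeLie →
      (∀ B ∈ 𝔞, ∀ B' ∈ 𝔞, B * B' - B' * B ∈ 𝔞) →
      (∃ Θ ∈ Submodule.span ℂ ((fun B : Module.End ℚ (bettiCohomology X'.X 1) => B.baseChange ℂ) ''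
          (𝔞 : Set (Module.End ℚ (bettiCohomology X'.X 1)))),
        ∀ p, ∀ x ∈ (BettiUniverse.hodge exists_isReal_hodgeModel_holds hX' 1).piece p (((1 : ℕ) : ℤ) - p),
          Θ x = ((2 * p - ((1 : ℕ) : ℤ) : ℤ) : ℂ) • x) →
      (BettiUniverse.hodge exists_isReal_hodgeModel_holds hX' 1).hodgeLie ≤ 𝔞 := by
  haveI := BettiUniverse.finite hX 1
  haveI := BettiUniverse.finite hX' 1
  obtain ⟨g, hg⟩ := h
  rw [Literature.AlgebraicGeometry.Pohlmann1968.hodge_one_eq_comapEquiv_of_isIsogeny hX hX' hg]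
  exact rigid_comapEquiv_of_rigid _ _ hrig

/-- **`t(R) ≤ t(X)` for every `X ∼ X₁ × X₂` with `X₁ ∼ R`, `H¹R` `Θ`-rigid** (`0 < dim R`; the rigid-factor monotonicity of
`CorCM/MumfordTateRankRigidMonotone` with the rigidity transported to `X₁` and `t(X₁) = t(R)`). [cite: MoonenZarhin1999LowDim, §3 (3.1)]
[cite: Moonen1999MTNotes, (1.7) and (1.8)] -/
theorem mtRank_hodge_one_le_of_isIsogenous_prod_of_isIsogenous_rigid (hX : IsSmoothProjective n X.X) (hR : IsSmoothProjective n₁ R.X)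
    (hR0 : 0 < R.dim)
    (hrig : haveI := BettiUniverse.finite hR 1
      ∀ 𝔞 : Submodule ℚ (Module.End ℚ (bettiCohomology R.X 1)),
        𝔞 ≤ (BettiUniverse.hodge exists_isReal_hodgeModel_holds hR 1).hodgeLie →
        (∀ B ∈ 𝔞, ∀ B' ∈ 𝔞, B * B' - B' * B ∈ 𝔞) →
        (∃ Θ ∈ Submodule.span ℂ ((fun B : Module.End ℚ (bettiCohomology R.X 1) => B.baseChange ℂ) ''
            (𝔞 : Set (Module.End ℚ (bettiCohomology R.X 1)))),
          ∀ p, ∀ x ∈ (BettiUniverse.hodge exists_isReal_hodgeModel_holds hR 1).piece p (((1 : ℕ) : ℤ) - p),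
            Θ x = ((2 * p - ((1 : ℕ) : ℤ) : ℤ) : ℂ) • x) →
        (BettiUniverse.hodge exists_isReal_hodgeModel_holds hR 1).hodgeLie ≤ 𝔞)
    (h₁ : IsIsogenous X₁ R) (hXP : IsIsogenous X (X₁.prod X₂)) :
    haveI := BettiUniverse.finite hX 1
    haveI := BettiUniverse.finite hR 1
    (BettiUniverse.hodge exists_isReal_hodgeModel_holds hR 1).mtRank ≤ (BettiUniverse.hodge exists_isReal_hodgeModel_holds hX 1).mtRank := by
  haveI := BettiUniverse.finite hX 1
  haveI := BettiUniverse.finite hR 1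
  have hX₁ : IsSmoothProjective X₁.dim X₁.X := AbelianVariety.isSmoothProjective_holds
  haveI := BettiUniverse.finite hX₁ 1
  have h0 : 0 < X₁.dim := by rw [(dim_eq_of_isIsogenous_holds h₁ : X₁.dim = R.dim)]; exact hR0
  have hrig₁ := hodgeLie_rigid_of_isIsogenous hR hX₁ h₁.symm' hrig
  have hle := mtRank_hodge_one_le_of_isIsogenous_prod_of_rigid hX hX₁ h0 hrig₁ hXP
  rw [Literature.AlgebraicGeometry.Pohlmann1968.mtRank_hodge_one_eq_of_isIsogenous hX₁ hR h₁] at hle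
  exact hle

end Summit.HodgeConjecture.CorCM

end
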